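import Mathlib.Algebra.Module.Submodule.Basic
import Mathlib.RingTheory.Ideal.Basic
import Mathlib.Algebra.Module.Torsion.Basic
import HarnessLib

/-!
# Route `ErratumRoadFive` (K2, `p ≥ 5`), crux (T) `Rest3TorsionBranchAtFive` (item
# stmt-BirchSwinnertonDyer-19702): a `π`-primary module whose `π^m`-torsion has exponent `π^j` with `j < m`
# has exponent `π^j` — the `g`-side of Lemma (L1) of THEOREM T♭ (memo §31.2 (g)), no a-priori finiteness

Cell `bsd-stepL` (run/shared/lean/pub/bsd-stepL/), seat `bsd-stepL-bdp` (prover g14, 2026-08-26), memo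
`HOME/proof/PROOF-BDP.md` §31.2 (g) / §32; `--supports stmt-BirchSwinnertonDyer-19702 --as helper`.

HONEST FRAMING: PURE ALGEBRA (theorems only; no definition, no named fact, no `sorry`); nothing about
Selmer groups, modular forms or any preprint is asserted; nothing is booked; no census word, tier or
label moves (T7).

## What and why

In THEOREM T♭ (Castella's erratum Thm. 1.1 without (iv)) the control defect on the side of the CONGRUENT
form `g = g_m` is `H⁰(K_{∞,w}, A_g)/ϖ^m`. One knows `A_g[ϖ^m] ≅ (E[p^∞] ⊗ 𝒪)[ϖ^m]` as Galois modules
(the congruence (b)), hence `H⁰(K_{∞,w}, A_g)[ϖ^m] ≅ (𝒪/p^k)[ϖ^m] = 𝒪/p^k` has exponent `ϖ^{ek}`, which is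
`< ϖ^m` once `m > ek` — but nothing is known a priori about the whole of `H⁰(K_{∞,w}, A_g)` (not even
finiteness). Memo §31.2 (g): «a `ϖ`-primary torsion `𝒪`-module whose `ϖ^m`-torsion has exponent `ϖ^j`
with `j < m` EQUALS its `ϖ^m`-torsion (an element of exact order `ϖ^t`, `t > j`, would produce one of
exact order `ϖ^{min(t,m)} > ϖ^j` inside the `ϖ^m`-torsion)». THIS FILE proves that sentence over any
commutative ring (referee ask R31-3):

* `pow_smul_eq_zero_of_torsionBy_exponent` — `M` an `R`-module in which every element is killed by
  some power of `a`, `j < m`, and every `x` with `a^m • x = 0` already has `a^j • x = 0`; then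
  `a^j • x = 0` for EVERY `x` (descending induction on the `a`-exponent of `x`);
* `torsionBy_pow_eq_top_of_exponent` — hence `M = M[a^m] = M[a^j]` (as `Submodule.torsionBy`);
* `pow_smul_eq_zero_of_torsionBy_exponent'` — the form with the hypothesis on the `a^m`-torsion stated
  as an inclusion `torsionBy (a^m) ≤ torsionBy (a^j)`.

So `H⁰(K_{∞,w}, A_g) = H⁰(K_{∞,w}, A_g)[ϖ^m] ≅ 𝒪/p^k` for `m > ek`: the SAME bound `p^{c₀}` as on the
`E`-side, independent of `m` — the uniformity that `BoundedCongruenceLimit.charIdeal_le_span_of_congruences_boundedKernel`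
(g13, p459436) consumes through its binders `n`, `k`.

References: [Castella2018Erratum] Lemma 2.1 and Remark (2) (p. 2); memo PROOF-BDP §31.2 (g).
-/

set_option autoImplicit false
-- the Theorems namespace of this sub repeats the summit name by design (D-0017 nested layout)
set_option linter.dupNamespace false

namespace Summit.BirchSwinnertonDyer.BirchSwinnertonDyer.Theorems.TateTorsionRigidity

universe u v

variable {R : Type u} [CommRing R] {M : Type v} [AddCommGroup M] [Module R M]

/-- **Exponent descent (memo §31.2 (g)).** Let `a ∈ R` and `M` an `R`-module in which every element is
killed by some power of `a` (`a`-primary). If `j < m` and every element killed by `a ^ m` is already killed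
by `a ^ j`, then EVERY element of `M` is killed by `a ^ j`. Proof: if `a^t x = 0` with `t > m`, then
`y = a^{t-m} x` is killed by `a^m`, hence by `a^j`, i.e. `a^{t-m+j} x = 0` with `t - m + j < t`; descend.
[folklore] -/
theorem pow_smul_eq_zero_of_torsionBy_exponent (a : R) {j m : ℕ} (hjm : j < m)
    (hprim : ∀ x : M, ∃ t : ℕ, a ^ t • x = 0)
    (hexp : ∀ x : M, a ^ m • x = 0 → a ^ j • x = 0) (x : M) : a ^ j • x = 0 := by
  obtain ⟨t, ht⟩ := hprim x
  -- descending induction on `t`, uniformly in `x`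
  induction t using Nat.strong_induction_on generalizing x with
  | _ t ih =>
    by_cases htm : t ≤ m
    · apply hexp
      rw [← Nat.sub_add_cancel htm, pow_add, mul_smul, ht, smul_zero]
    · push Not at htm
      -- `y = a^{t-m} • x` is killed by `a^m`, hence by `a^j`
      have hy : a ^ m • (a ^ (t - m) • x) = 0 := by
        rw [← mul_smul, ← pow_add, Nat.add_sub_cancel' htm.le, ht]
      have hy' : a ^ (t - m + j) • x = 0 := by
        rw [pow_add, mul_comm, mul_smul, hexp _ hy]
      exact ih (t - m + j) (by omega) x hy'

/-- The same with the hypothesis on the `a^m`-torsion as an inclusion of torsion submodules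
`M[a^m] ≤ M[a^j]`. [folklore] -/
theorem pow_smul_eq_zero_of_torsionBy_exponent' (a : R) {j m : ℕ} (hjm : j < m)
    (hprim : ∀ x : M, ∃ t : ℕ, a ^ t • x = 0)
    (hle : Submodule.torsionBy R M (a ^ m) ≤ Submodule.torsionBy R M (a ^ j)) (x : M) :
    a ^ j • x = 0 :=
  pow_smul_eq_zero_of_torsionBy_exponent a hjm hprim
    (fun _ hy => (Submodule.mem_torsionBy_iff _ _).mp (hle ((Submodule.mem_torsionBy_iff _ _).mpr hy))) x

/-- **`M = M[a^m] = M[a^j]`**: under the hypotheses of `pow_smul_eq_zero_of_torsionBy_exponent` the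
`a^j`-torsion (and a fortiori the `a^m`-torsion) submodule is all of `M` — «a `ϖ`-primary module whose
`ϖ^m`-torsion has exponent `ϖ^j`, `j < m`, equals its `ϖ^m`-torsion». [folklore] -/
theorem torsionBy_pow_eq_top_of_exponent (a : R) {j m : ℕ} (hjm : j < m)
    (hprim : ∀ x : M, ∃ t : ℕ, a ^ t • x = 0)
    (hexp : ∀ x : M, a ^ m • x = 0 → a ^ j • x = 0) :
    Submodule.torsionBy R M (a ^ j) = ⊤ ∧ Submodule.torsionBy R M (a ^ m) = ⊤ := by
  have hj : ∀ x : M, a ^ j • x = 0 := pow_smul_eq_zero_of_torsionBy_exponent a hjm hprim hexp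
  refine ⟨Submodule.eq_top_iff'.mpr fun x => (Submodule.mem_torsionBy_iff _ _).mpr (hj x),
    Submodule.eq_top_iff'.mpr fun x => (Submodule.mem_torsionBy_iff _ _).mpr ?_⟩
  rw [← Nat.sub_add_cancel hjm.le, pow_add, mul_smul, hj x, smul_zero]

end Summit.BirchSwinnertonDyer.BirchSwinnertonDyer.Theorems.TateTorsionRigidity
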